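import Summits.AnomalousDissipation.AnomalousDissipation.Theorems.TaylorGreenLogLoudStates.Negative.Eigenforce

/-!
# Route MirrorVariety — support item `EigenforceWorkIdentity` (stmt-AnomalousDissipation-14587)

**Eigenforce work identity.** For every resolution `N ≥ 2` and every admissible Galerkin steady state `U` of the
Taylor–Green force `f_TG = (sin2πx₀ cos2πx₁ cos2πx₂, −cos2πx₀ sin2πx₁ cos2πx₂, 0)` at `(N, ν)` (smooth, div-free,
mean-zero, band-limited to `0 < |k|² ≤ N²`, solving the tested Galerkin equations
`∫ (⟪U,(U·∇)a⟫ + ν⟪U,Δa⟫ + ⟪f_TG,a⟫) = 0` against every band-limited smooth div-free `a`):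

* `12π²ν ∫⟪f_TG, U⟫ = 1/4 + ∫⟪U, (U·∇)f_TG⟫` — test with `a := f_TG` itself (admissible for `N ≥ 2`: its Fourier
  support is the shell `|k|² = 3 ≤ N²`), use the Stokes-eigenfield relation `Δf_TG = −12π² f_TG` and
  `∫‖f_TG‖² = 1/4` — this is the landed `TaylorGreenLogLoudStates.Negative.eigenforce_identity`;
* `∫⟪f_TG, U⟫ = ν‖∇U‖²` — test with `a := U` — the landed `TaylorGreenLoudGalerkinStates.Negative.energy_identity`
  (Temam 1979 Ch. II (1.29)).

This file only assembles the two landed halves into the route declaration: the item's `∀ f, f = f_TG → …` binder and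
its unfolded admissibility bracket are, by `rfl`, the negative files' `tgForce` and `IsSteadyState ν N tgForce U`.

Sources: R. Temam, *Navier–Stokes Equations* (1979), Ch. II §1, (1.25)/(1.29) [Temam1979]; M. Brachet et al.,
J. Fluid Mech. 130 (1983) (the Taylor–Green vortex) [BrachetEtAl1983]. The computation itself is folklore.
-/

-- `Summit.<Summit>.<Problem>` is the tree's mandated summit-side namespace (CONVENTIONS §2); for this
-- single-conjunct summit the two coincide, so the duplicate is deliberate.
set_option linter.dupNamespace false

noncomputable section

namespace Summit.AnomalousDissipation.AnomalousDissipation.Theorems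

open Summit.AnomalousDissipation.AnomalousDissipation.Theorems.TaylorGreenLoudGalerkinStates.Negative
open Summit.AnomalousDissipation.AnomalousDissipation.Theorems.TaylorGreenLogLoudStates.Negative

/-- **`MirrorVariety.EigenforceWorkIdentity` holds** (item stmt-AnomalousDissipation-14587): for `N ≥ 2`, every
admissible Galerkin steady Taylor–Green state `U` at `(N, ν)` satisfies
`12π²ν ∫⟪f_TG, U⟫ = 1/4 + ∫⟪U, (U·∇)f_TG⟫` (test with `a := f_TG`, `Δf_TG = −12π²f_TG`, `∫‖f_TG‖² = 1/4`;
`Negative.eigenforce_identity`) and `∫⟪f_TG, U⟫ = ν‖∇U‖²` (test with `a := U`; `Negative.energy_identity`,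
Temam 1979 Ch. II (1.29)). [folklore] -/
theorem eigenforceWorkIdentity_proof :
    Summit.AnomalousDissipation.AnomalousDissipation.Theses.MirrorVariety.EigenforceWorkIdentity := by
  unfold Summit.AnomalousDissipation.AnomalousDissipation.Theses.MirrorVariety.EigenforceWorkIdentity
  intro f hf ν N U hN hU
  have hf' : f = tgForce := hf
  subst hf'
  have hU' : IsSteadyState ν N tgForce U := hU
  exact ⟨eigenforce_identity hN hU', (energy_identity hU' continuous_tgForce).symm⟩

end Summit.AnomalousDissipation.AnomalousDissipation.Theorems

end
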